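import Summits.BirchSwinnertonDyer.Rank1Residual.GaloisImage.RationalTorsionLinePlaneCount
import Summits.BirchSwinnertonDyer.Rank1Residual.GaloisImage.ThreeLagrangianLocalConditions
import Summits.BirchSwinnertonDyer.Rank1Residual.GaloisImage.TwoLagrangianLinesPairing
import Summits.BirchSwinnertonDyer.Rank1Residual.GaloisImage.NonsplitMultiplicativeKummerTransport
import HarnessLib

/-!
# The three-Lagrangian lemma ON `H¹(K_v, E[p])`: binders (i)(ii)(iii) of p02's wrapper DISCHARGED at
# a place `v ∣ p` with `t_v = p`, and the corollary `d_p ∈ {0, 2}` with only the `(0,0)` binders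
# displayed (cell `b2b-bsdres`, team n1011, seat p12 GEN 11 — TOOL file; row T-K43-COH, FILE 2;
# skeleton `cells/n1011/skel/T-K43-COH.md`; lead R5-87 (c) / R5-88; referee-1 GEN 37 ACK-1)

HONEST FRAMING (cell `b2b-bsdres`, run/shared/lean/b2b/bsd-rank1-residual/, verbatim in every
file): the goal of the cell is to DELETE the COMBINATION-SHAPED residual classes of the
Birch–Swinnerton-Dyer formula for ALL analytic-rank `≤ 1` elliptic curves over `ℚ` — "full BSD
formula for every rank `≤ 1` curve in class `C`" assembled STRICTLY from published theorems — so
that the rank-`≤ 1` remainder becomes exactly the CONSTRUCTION-SHAPED classes, which are TYPED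
(missing-input `Prop`s), NOT attempted. This is not "finishing BSD". Team n1011 (N10 / N11, the
additive block `X4 ∧ p = 3`): research route on a CONSTRUCTION-SHAPED class; no claim beyond the
stated classes; labels UNCHANGED; nothing is booked; census output = EVIDENCE, never a Literature
fact. TOOL THEOREMS ONLY: no definition, no named fact; closes nothing by itself. Every
cohomological input is a THEOREM of the tree: Tate local duality for `E[p]`
(`eq_zero_of_forall_weilCupProduct_eq_zero`, `localDuality_bijective`), Tate's Euler–Poincaré
characteristic (`natCard_galoisCohomology_one_torsion_adicCompletion_eq_sq` with
`EP.localEulerPoincareCharacteristic_adicCompletion`), the discharged Poonen–Rains isotropy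
(`cupProduct_eq_zero_of_mem_kummerLocalConditionAt_of_fact` ∘ `kummerClass_cupProduct_kummerClass_eq_zero_holds`),
its transport along a congruence and the SYMMETRY of the Weil cup product (p04's T-2LL FILE 2b
`TwoLagrangianLines.cupProduct_map_map_eq_zero_of_mem_kummerLocalConditionAt` /
`TwoLagrangianLines.weilCupProduct_comm`, BY NAME), the rational line's plane (FILE 1a/1b of this
row), and p02's group-currency wrapper `ThreeLagrangian.addSubgroup_eq_or_inf_eq_bot` (T-K43-TOOL
F3, BY NAME). Lead R5-87 (c): "Tate local duality for `E[3]/ℚ₃` is a THEOREM of the tree …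
consume BY NAME, 0 displayed duality binders" — this file is that consumption.

## Setting and statement (r1 ROUTE-1 §43.1 COROLLARY)

`K` a number field, `v` a finite place, `p` an ODD prime, `E = W`, `E′ = W′` elliptic curves over
`K` with a `p`-congruence `θ : E′[p] ≃ E[p]` (`Γ_K`-equivariant; `f` its restriction to `Γ_{K_v}` in
the tree's `→ⁱL` currency, `hf : f = θ`), and the census-decidable data of the place:
`htors : #E(K_v)[p] = p` ("`t_v = p`"), `h𝓞 : #(𝓞_v ⧸ p) = p` (`K_v` has residue degree × ramification
`1` over `ℚ_p`; automatic for `K = ℚ`), `hμ : K_v ∌ ζ_p` (`∀ ζ, ζ^p = 1 → ζ = 1`; automatic for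
`ℚ_p`, `p` odd — §3 discharges it at `3` by p17's square-flag lemma), and `T ∈ E[p](K̄)` non-zero
and `Γ_{K_v}`-fixed (a generator of `E(K_v)[p]`). Local conditions in `H := H¹(K_v, E[p])`:
`𝓛₁ := 𝓛_v(E) = W.kummerLocalConditionAt p K_v`, `L₂ := θ_* 𝓛_v(E′) = (𝓛_v(E′)).map H¹(f)`, and
the third Lagrangian `W_T = ι_* H¹(K_v, ⟨T⟩)` = the classes represented by a `⟨T⟩`-valued crossed
homomorphism (FILE 1a `cohomologyMap_rightHom_eq_zero_iff`). The `(0,0)` condition of r1 §42–43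
(`A(E) = 0 = A(E′)`: `𝓛₁ ∩ W_T = 0 = L₂ ∩ W_T`) is DISPLAYED, in the pairing-free cocycle form

  `h00 : ∀ x ∈ 𝓛₁, (∃ φ, [φ] = x ∧ ∀ σ, φ σ ∈ ℤT) → x = 0`   (and `h00′` for `L₂`),

per-pair EVIDENCE (r1's Tate–Lichtenbaum instrument reads it; NO kernel decider for `A` is offered
or implied here). CONCLUSION (`kummerLocalConditionAt_eq_or_inf_map_eq_bot`):

  `𝓛₁ = L₂ ∨ 𝓛₁ ⊓ L₂ = ⊥`  — the local cost `d_p := 2 − dim(𝓛₁ ∩ L₂)` is `0` or `2`, never `1`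

(FILE 2b `ThreeLagrangianCohomologyReadings`: the `Nat.card` readings `#(𝓛₁ ⊓ L₂) ∈ {p², 1}`,
`≠ p`, and the `K = ℚ`, `p = 3` twin with `h𝓞`, `hμ`, `hp2` discharged). CAVEATS (skeleton §2, referee-1 GEN 37 (iii),
verbatim): d = 1 only — the dichotomy is special to `[K_v : ℚ_p] = 1` (`dim H = 4`; for `d > 1`
transverse Lagrangians are graphs of alternating forms on a `2d`-space and `d_p = 1`-type
intersections occur); p ≠ 2 — `hp2` is load-bearing (the argument runs over ALTERNATING `2 × 2`
forms because the cup product is SYMMETRIC; char `2` is excluded); no global statement — nothing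
here identifies Selmer groups or decides `d_p = 0` versus `2` (that is r1's S43-SPLIT / S43-NONSPLIT,
records ST-43a/b).

Mechanism (`exists_threeLagrangian_binders`): choose a Weil pairing `e` (`exists_weilPairing_holds`); the
`ZMod p`-valued pairing `q(x, y) := inv(H²(μ-iso)(x ∪ₑ y))` (`inv` injective from
`localDuality_bijective`, exactly as inside the tree's
`forall_mem_kummerLocalConditionAt_weilCupProduct_eq_zero_iff`) is symmetric (2b) and
non-degenerate (Tate); `#H = p⁴` (`natCard_galoisCohomology_one_eq_pow_four`), `#𝓛₁ = p² = #L₂`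
(`natCard_kummerLocalConditionAt_eq_sq`, `natCard_map_kummerLocalConditionAt_eq_sq`: `H¹(f)` is
injective, `NonsplitKummer.map_injective_of_leftInverse`, and `#𝓛_v(E′) = #𝓛_v(E)`,
`NonsplitKummer.natCard_kummerLocalConditionAt_eq_of_congr`), `#W_T = p²` (FILE 1b), the three
isotropies, and `𝓛ᵢ ⊓ W_T = ⊥` from `h00`/`h00′`; then p02's F3.
-/

noncomputable section

open scoped Classical
open CategoryTheory Function Field NumberField IsDedekindDomain WeierstrassCurve
  Literature.NumberTheory.EllipticCurves Literature.NumberTheory.GaloisRepresentations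
open Literature.NumberTheory.GaloisRepresentations.DiscreteGaloisModule (mu MuCarrier)
open scoped ContRepresentation

namespace Summit.BirchSwinnertonDyer.Rank1Residual.GaloisImage.ThreeLagrangianCoh

-- `H²`, cup products and the tree's `IsSES` need `CompactSpace Γ_{K_v}`: obtained inside the proofs
-- by `absoluteGaloisGroup_compactSpace` (no file-level instance attribute: kernel lane).

/-! ## §1 Binders (i) and (ii): the counts `#H¹(K_v, E[p]) = p⁴`, `#𝓛_v(E) = p² = #θ_*𝓛_v(E′)` -/

section Counts

variable {K : Type} [Field K] [NumberField K] (W W' : WeierstrassCurve K) [W.IsElliptic]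
  [W'.IsElliptic] (v : HeightOneSpectrum (𝓞 K)) (p : ℕ) [hp : Fact p.Prime]

/-- **Binder (i), count: `#H¹(K_v, E[p]) = p⁴`** when `#E(K_v)[p] = p` and `#(𝓞_v/p) = p` — Tate's
local Euler–Poincaré characteristic `#H¹ = (#E(K_v)[p] · #(𝓞_v/p))²` (tree THEOREM
`natCard_galoisCohomology_one_torsion_adicCompletion_eq_sq`, `hEP` discharged by
`EP.localEulerPoincareCharacteristic_adicCompletion`). r1 §43.1 (i) "dim H = h⁰ + h² + 2 = 4".
[cite: MilneADT2006, Ch. I §2, Thm. 2.8 and §3 Lemma 3.3] -/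
theorem natCard_galoisCohomology_one_eq_pow_four
    (htors : Nat.card (nsmulAddMonoidHom p :
      (W.baseChange (v.adicCompletion K)).toAffine.Point →+ _).ker = p)
    (h𝓞 : Nat.card (v.adicCompletionIntegers K ⧸
      Ideal.span {((p : ℕ) : v.adicCompletionIntegers K)}) = p) :
    Nat.card (galoisCohomology
      (GaloisRep.restrictField (v.adicCompletion K) (W.torsionGaloisModule p)) 1) = p ^ 4 := by
  rw [natCard_galoisCohomology_one_torsion_adicCompletion_eq_sq W v p hp.out.isPrimePow
    (EP.localEulerPoincareCharacteristic_adicCompletion K v), htors, h𝓞]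
  ring

/-- **Binder (ii), count: `#𝓛_v(E) = p²`** when `#E(K_v)[p] = p` and `#(𝓞_v/p) = p`
(`#𝓛_v = #E(K_v)[p] · #(𝓞_v/p)`, tree `natCard_kummerLocalConditionAt_adicCompletion`).
r1 §43.1 (ii) "dim L_E = dim E(ℚ₃)[3] + [ℚ₃:ℚ₃] = 2". [cite: MilneADT2006, I Lemma 3.3] -/
theorem natCard_kummerLocalConditionAt_eq_sq
    (htors : Nat.card (nsmulAddMonoidHom p :
      (W.baseChange (v.adicCompletion K)).toAffine.Point →+ _).ker = p)
    (h𝓞 : Nat.card (v.adicCompletionIntegers K ⧸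
      Ideal.span {((p : ℕ) : v.adicCompletionIntegers K)}) = p) :
    Nat.card (W.kummerLocalConditionAt p (v.adicCompletion K)) = p ^ 2 := by
  rw [W.natCard_kummerLocalConditionAt_adicCompletion v hp.out.ne_zero, htors, h𝓞, sq]

/-- **`#θ_* 𝓛_v(E′) = #𝓛_v(E)`** for a `p`-congruence `θ : E′[p] ≃ E[p]` and its local
intertwining map `f` (`f = θ` pointwise): `H¹(f)` is injective (left inverse from `θ⁻¹`,
`NonsplitKummer.map_injective_of_leftInverse`) and `#𝓛_v(E′) = #𝓛_v(E)`
(`NonsplitKummer.natCard_kummerLocalConditionAt_eq_of_congr`). [cite: MilneADT2006, I Lemma 3.3] -/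
theorem natCard_map_kummerLocalConditionAt_eq
    (θ : geomTorsion W' (p : ℤ) ≃+ geomTorsion W (p : ℤ))
    (hθ : ∀ (σ : absoluteGaloisGroup K) (P : geomTorsion W' (p : ℤ)), θ (σ • P) = σ • θ P)
    (f : (GaloisRep.restrictField (v.adicCompletion K)
        (W'.torsionGaloisModule (p : ℤ))).toContRepresentation →ⁱL
      (GaloisRep.restrictField (v.adicCompletion K)
        (W.torsionGaloisModule (p : ℤ))).toContRepresentation)
    (hf : ∀ x, f x = θ x) :
    Nat.card ((W'.kummerLocalConditionAt p (v.adicCompletion K)).map (galoisCohomology.map f 1)) =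
      Nat.card (W.kummerLocalConditionAt p (v.adicCompletion K)) := by
  have hθ' : ∀ (σ : absoluteGaloisGroup K) (P : geomTorsion W (p : ℤ)),
      θ.symm (σ • P) = σ • θ.symm P := fun σ P ↦ by
    apply θ.injective
    rw [AddEquiv.apply_symm_apply, hθ, AddEquiv.apply_symm_apply]
  let gθ : (W.torsionGaloisModule (p : ℤ)).toContRepresentation →ⁱL
      (W'.torsionGaloisModule (p : ℤ)).toContRepresentation :=
    { toContinuousLinearMap := ⟨θ.symm.toAddMonoidHom.toIntLinearMap,
        continuous_of_discreteTopology⟩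
      isIntertwining' := fun σ ↦ ContinuousLinearMap.ext fun P ↦ hθ' σ P }
  let g := gθ.restrictField (v.adicCompletion K)
  have hgf : ∀ x, g (f x) = x := fun x ↦ by
    change θ.symm (f x) = x
    rw [hf]
    exact θ.symm_apply_apply x
  have hinj := NonsplitKummer.map_injective_of_leftInverse W' W f g hgf
  rw [NonsplitKummer.natCard_kummerLocalConditionAt_eq_of_congr W W' v θ hθ]
  exact Nat.card_congr ((AddSubgroup.equivMapOfInjective _ _ hinj).symm.toEquiv)

end Counts

/-! ## §2 The assembly: `d_p ∈ {0, 2}` on `H¹(K_v, E[p])` -/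

section Assembly

variable {K : Type} [Field K] [NumberField K] (W W' : WeierstrassCurve K) [W.IsElliptic]
  [W'.IsElliptic] (v : HeightOneSpectrum (𝓞 K)) (p : ℕ) [hp : Fact p.Prime]

/-- **All twelve binders of p02's wrapper `ThreeLagrangian.addSubgroup_eq_or_inf_eq_bot`, from the
tree** (assembly step; consumed by the END below and by FILE 2b's `Nat.card` readings): for a chosen Weil
pairing the `ZMod p`-valued pairing `q = inv ∘ H²(μ-iso) ∘ ∪ₑ` on `H = H¹(K_v, E[p])` is symmetric
(p04 `TwoLagrangianLines.weilCupProduct_comm`) and non-degenerate (Tate,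
`eq_zero_of_forall_weilCupProduct_eq_zero`); `#H = p⁴`, `#W_T = #𝓛₁ = #L₂ = p²`; `W_T`, `𝓛₁`, `L₂`
are isotropic (FILE 1a; Poonen–Rains; its transport, p04); and `𝓛ᵢ ⊓ W_T = ⊥` from the displayed
`(0,0)` binders via FILE 1a's cocycle description of `W_T`. [folklore] -/
theorem exists_threeLagrangian_binders
    (htors : Nat.card (nsmulAddMonoidHom p :
      (W.baseChange (v.adicCompletion K)).toAffine.Point →+ _).ker = p)
    (h𝓞 : Nat.card (v.adicCompletionIntegers K ⧸
      Ideal.span {((p : ℕ) : v.adicCompletionIntegers K)}) = p)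
    (hμ : ∀ ζ : v.adicCompletion K, ζ ^ p = 1 → ζ = 1)
    (T : geomTorsion W p)
    (hT : ∀ σ : absoluteGaloisGroup (v.adicCompletion K),
      absGaloisRestrict K (v.adicCompletion K) σ • T = T) (hT0 : T ≠ 0)
    (θ : geomTorsion W' (p : ℤ) ≃+ geomTorsion W (p : ℤ))
    (hθ : ∀ (σ : absoluteGaloisGroup K) (P : geomTorsion W' (p : ℤ)), θ (σ • P) = σ • θ P)
    (f : (GaloisRep.restrictField (v.adicCompletion K)
        (W'.torsionGaloisModule (p : ℤ))).toContRepresentation →ⁱL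
      (GaloisRep.restrictField (v.adicCompletion K)
        (W.torsionGaloisModule (p : ℤ))).toContRepresentation)
    (hf : ∀ x, f x = θ x)
    (h00 : ∀ x ∈ W.kummerLocalConditionAt p (v.adicCompletion K),
      (∃ φ : contOneCocycles (GaloisRep.restrictField (v.adicCompletion K)
          (W.torsionGaloisModule p)).toTopRep,
        oneCocycleClass _ φ = x ∧ ∀ σ, φ.1 σ ∈ AddSubgroup.zmultiples T) → x = 0)
    (h00' : ∀ x ∈ (W'.kummerLocalConditionAt p (v.adicCompletion K)).map (galoisCohomology.map f 1),
      (∃ φ : contOneCocycles (GaloisRep.restrictField (v.adicCompletion K)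
          (W.torsionGaloisModule p)).toTopRep,
        oneCocycleClass _ φ = x ∧ ∀ σ, φ.1 σ ∈ AddSubgroup.zmultiples T) → x = 0) :
    ∃ (W₀ : AddSubgroup (galoisCohomology
        (GaloisRep.restrictField (v.adicCompletion K) (W.torsionGaloisModule p)) 1))
      (q : galoisCohomology (GaloisRep.restrictField (v.adicCompletion K) (W.torsionGaloisModule p)) 1 →+
        galoisCohomology (GaloisRep.restrictField (v.adicCompletion K) (W.torsionGaloisModule p)) 1 →+
          ZMod p),
      (∀ x y, q x y = q y x) ∧ (∀ x, (∀ y, q x y = 0) → x = 0) ∧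
      Nat.card (galoisCohomology
        (GaloisRep.restrictField (v.adicCompletion K) (W.torsionGaloisModule p)) 1) = p ^ 4 ∧
      Nat.card W₀ = p ^ 2 ∧
      Nat.card (W.kummerLocalConditionAt p (v.adicCompletion K)) = p ^ 2 ∧
      Nat.card ((W'.kummerLocalConditionAt p (v.adicCompletion K)).map (galoisCohomology.map f 1))
        = p ^ 2 ∧
      (∀ x ∈ W₀, ∀ y ∈ W₀, q x y = 0) ∧
      (∀ x ∈ W.kummerLocalConditionAt p (v.adicCompletion K),
        ∀ y ∈ W.kummerLocalConditionAt p (v.adicCompletion K), q x y = 0) ∧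
      (∀ x ∈ (W'.kummerLocalConditionAt p (v.adicCompletion K)).map (galoisCohomology.map f 1),
        ∀ y ∈ (W'.kummerLocalConditionAt p (v.adicCompletion K)).map (galoisCohomology.map f 1),
          q x y = 0) ∧
      W.kummerLocalConditionAt p (v.adicCompletion K) ⊓ W₀ = ⊥ ∧
      (W'.kummerLocalConditionAt p (v.adicCompletion K)).map (galoisCohomology.map f 1) ⊓ W₀ = ⊥ := by
  have hpp := hp.out
  let F := v.adicCompletion K
  haveI : CharZero F := charZero_adicCompletion v
  haveI := absoluteGaloisGroup_compactSpace F
  haveI : PerfectField K := PerfectField.ofCharZero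
  have hpZ : ((p : ℕ) : ℤ) ≠ 0 := by exact_mod_cast hpp.ne_zero
  -- a Weil pairing on `E[p]`
  obtain ⟨e, hμe, hadd₁, hadd₂, halt, hnondeg, hgal⟩ :=
    exists_weilPairing_holds W p hpp.two_le (by exact_mod_cast hpp.ne_zero)
  let P := (weilContPairing W p e hμe hadd₁ hadd₂ hgal).restrict (absGaloisRestrict K F)
  -- the third Lagrangian `W_T = ker H¹(e(·,T))`
  let W₀ : AddSubgroup (galoisCohomology (GaloisRep.restrictField F (W.torsionGaloisModule p)) 1) :=
    (cohomologyMap (P.rightHom T hT) 1).hom.toLinearMap.toAddMonoidHom.ker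
  have hmemW₀ : ∀ x, x ∈ W₀ ↔ cohomologyMap (P.rightHom T hT) 1 x = 0 := fun x ↦ Iff.rfl
  -- the `ZMod p`-valued refinement `q(x, y) = inv(H²(μ-iso)(x ∪ₑ y))` of the cup product
  haveI : Finite (geomTorsion W p) := finite_geomTorsion_of_neZero W p
  obtain ⟨ι, hι, -, -⟩ := localDuality_bijective F
    (GaloisRep.restrictField F (W.torsionGaloisModule p) :
      ContinuousRep (absoluteGaloisGroup F) ℤ (geomTorsion W p))
    (fun T : geomTorsion W p => AddSubgroup.torsionBy.nsmul T)
  let inv : galoisCohomology (GaloisRep.restrictField F (mu K p)) 2 →+ ZMod p :=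
    ι.comp (cohomologyMap (muRestrictIso K p F).hom 2).hom.toLinearMap.toAddMonoidHom
  have hinv : Injective inv :=
    hι.comp (continuousCohomologyEquivOfIso (muRestrictIso K p F) 2).injective
  have hinv0 : ∀ z, inv z = 0 ↔ z = 0 := fun z ↦
    ⟨fun h ↦ hinv (h.trans (map_zero inv).symm), fun h ↦ by rw [h, map_zero]⟩
  let q : galoisCohomology (GaloisRep.restrictField F (W.torsionGaloisModule p)) 1 →+
      galoisCohomology (GaloisRep.restrictField F (W.torsionGaloisModule p)) 1 →+ ZMod p :=
    AddMonoidHom.mk' (fun x => inv.comp (P.cupProduct x).toAddMonoidHom)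
      fun x x' => AddMonoidHom.ext fun y => by
        change inv (P.cupProduct (x + x') y) = inv (P.cupProduct x y) + inv (P.cupProduct x' y)
        exact (congrArg inv (DFunLike.congr_fun (map_add P.cupProduct x x') y)).trans (map_add inv _ _)
  have hq : ∀ x y, q x y = inv (P.cupProduct x y) := fun _ _ => rfl
  refine ⟨W₀, q, fun x y ↦ ?_, fun x hx ↦ ?_, natCard_galoisCohomology_one_eq_pow_four W v p htors h𝓞,
    ?_, natCard_kummerLocalConditionAt_eq_sq W v p htors h𝓞, ?_, fun x hx y hy ↦ ?_,
    fun x hx y hy ↦ ?_, ?_, ?_, ?_⟩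
  · -- symmetry (p04 T-2LL FILE 2b)
    rw [hq, hq, TwoLagrangianLines.weilCupProduct_comm W p e hμe hadd₁ hadd₂ F hgal halt x y]
  · -- non-degeneracy (Tate local duality for `E[p]`)
    refine eq_zero_of_forall_weilCupProduct_eq_zero W p e hμe hadd₁ hadd₂ F hgal hnondeg x fun y ↦ ?_
    exact (hinv0 _).mp (hx y)
  · -- `#W_T = p²` (FILE 1b)
    have h := natCard_ker_cohomologyMap_rightHom_eq W v p e hμe hadd₁ hadd₂ hgal halt hnondeg T hT hT0 hμ
    rw [h𝓞, ← sq] at h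
    exact h
  · -- `#L₂ = p²`
    rw [natCard_map_kummerLocalConditionAt_eq W W' v p θ hθ f hf,
      natCard_kummerLocalConditionAt_eq_sq W v p htors h𝓞]
  · -- `W_T` isotropic (FILE 1a)
    rw [hq, hinv0]
    exact cupProduct_eq_zero_of_rightHom_eq_zero W p e hμe hadd₁ hadd₂ hgal F halt hnondeg T hT hT0
      ((hmemW₀ x).mp hx) ((hmemW₀ y).mp hy)
  · -- `𝓛₁` isotropic (Poonen–Rains, discharged in the tree)
    rw [hq, hinv0]
    exact W.cupProduct_eq_zero_of_mem_kummerLocalConditionAt_of_fact p e hpZ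
      (kummerClass_cupProduct_kummerClass_eq_zero_holds F) hμe hadd₁ hadd₂ halt hgal hx hy
  · -- `L₂` isotropic (p04 T-2LL FILE 2b)
    rintro x ⟨x', hx', rfl⟩ y ⟨y', hy', rfl⟩
    rw [hq, hinv0]
    exact TwoLagrangianLines.cupProduct_map_map_eq_zero_of_mem_kummerLocalConditionAt W W' v e hμe
      hadd₁ hadd₂ θ hθ hgal halt f hf hx' hy'
  · -- `𝓛₁ ⊓ W_T = ⊥` from `h00`
    refine eq_bot_iff.mpr fun x hx ↦ (AddSubgroup.mem_bot).mpr (h00 x hx.1 ?_)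
    exact (cohomologyMap_rightHom_eq_zero_iff W p e hμe hadd₁ hadd₂ hgal F halt hnondeg T hT hT0 x).mp
      ((hmemW₀ x).mp hx.2)
  · -- `L₂ ⊓ W_T = ⊥` from `h00′`
    refine eq_bot_iff.mpr fun x hx ↦ (AddSubgroup.mem_bot).mpr (h00' x hx.1 ?_)
    exact (cohomologyMap_rightHom_eq_zero_iff W p e hμe hadd₁ hadd₂ hgal F halt hnondeg T hT hT0 x).mp
      ((hmemW₀ x).mp hx.2)

/-- **The three-Lagrangian COROLLARY on `H¹(K_v, E[p])`: `d_p ∈ {0, 2}`** (r1 ROUTE-1 §43.1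
COROLLARY "UNCONDITIONALLY and LOCALLY", binders (i)(ii)(iii) now THEOREMS; lead R5-87 (c) "0
displayed duality binders"). For an odd prime `p`, a place `v` with `#E(K_v)[p] = p`,
`#(𝓞_v/p) = p`, `K_v ∌ ζ_p`, a non-zero `Γ_{K_v}`-fixed `T ∈ E[p]`, a `p`-congruence `θ : E′[p] ≃ E[p]`
with local map `f`, and the DISPLAYED `(0,0)` binders `h00`, `h00′` (no non-zero class of `𝓛_v(E)`,
resp. of `θ_*𝓛_v(E′)`, is represented by a `⟨T⟩`-valued crossed homomorphism — r1 §42's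
`A(E) = 0 = A(E′)`, per-pair EVIDENCE; no kernel decider for `A` is offered or implied):

  `𝓛_v(E) = θ_* 𝓛_v(E′) ∨ 𝓛_v(E) ⊓ θ_* 𝓛_v(E′) = ⊥`.

CAVEATS (verbatim, skeleton §2 / referee-1 GEN 37 (iii)): d = 1 only (`[K_v : ℚ_p] = 1`, forced by
`h𝓞`; the dichotomy fails for `d > 1`); p ≠ 2 (load-bearing: symmetric cup product ⇒ ALTERNATING
graph forms); no global statement (nothing about Selmer groups; `d_p = 0` versus `2` is NOT decided
here — r1's S43-SPLIT / S43-NONSPLIT, records ST-43a/b). Proof: `exists_binders` ∘ p02's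
`ThreeLagrangian.addSubgroup_eq_or_inf_eq_bot` BY NAME.
[cite: MilneADT2006, Ch. I, Cor. 2.3 and Thm. 2.8] [cite: PoonenRains2012, Prop. 4.10 (arXiv:1009.0287v2 numbering; = JAMS 25 Prop. 4.11)] -/
theorem kummerLocalConditionAt_eq_or_inf_map_eq_bot (hp2 : p ≠ 2)
    (htors : Nat.card (nsmulAddMonoidHom p :
      (W.baseChange (v.adicCompletion K)).toAffine.Point →+ _).ker = p)
    (h𝓞 : Nat.card (v.adicCompletionIntegers K ⧸
      Ideal.span {((p : ℕ) : v.adicCompletionIntegers K)}) = p)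
    (hμ : ∀ ζ : v.adicCompletion K, ζ ^ p = 1 → ζ = 1)
    (T : geomTorsion W p)
    (hT : ∀ σ : absoluteGaloisGroup (v.adicCompletion K),
      absGaloisRestrict K (v.adicCompletion K) σ • T = T) (hT0 : T ≠ 0)
    (θ : geomTorsion W' (p : ℤ) ≃+ geomTorsion W (p : ℤ))
    (hθ : ∀ (σ : absoluteGaloisGroup K) (P : geomTorsion W' (p : ℤ)), θ (σ • P) = σ • θ P)
    (f : (GaloisRep.restrictField (v.adicCompletion K)
        (W'.torsionGaloisModule (p : ℤ))).toContRepresentation →ⁱL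
      (GaloisRep.restrictField (v.adicCompletion K)
        (W.torsionGaloisModule (p : ℤ))).toContRepresentation)
    (hf : ∀ x, f x = θ x)
    (h00 : ∀ x ∈ W.kummerLocalConditionAt p (v.adicCompletion K),
      (∃ φ : contOneCocycles (GaloisRep.restrictField (v.adicCompletion K)
          (W.torsionGaloisModule p)).toTopRep,
        oneCocycleClass _ φ = x ∧ ∀ σ, φ.1 σ ∈ AddSubgroup.zmultiples T) → x = 0)
    (h00' : ∀ x ∈ (W'.kummerLocalConditionAt p (v.adicCompletion K)).map (galoisCohomology.map f 1),
      (∃ φ : contOneCocycles (GaloisRep.restrictField (v.adicCompletion K)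
          (W.torsionGaloisModule p)).toTopRep,
        oneCocycleClass _ φ = x ∧ ∀ σ, φ.1 σ ∈ AddSubgroup.zmultiples T) → x = 0) :
    W.kummerLocalConditionAt p (v.adicCompletion K) =
        (W'.kummerLocalConditionAt p (v.adicCompletion K)).map (galoisCohomology.map f 1) ∨
      W.kummerLocalConditionAt p (v.adicCompletion K) ⊓
        (W'.kummerLocalConditionAt p (v.adicCompletion K)).map (galoisCohomology.map f 1) = ⊥ := by
  obtain ⟨W₀, q, hqs, hqnd, hH, hWc, hL₁c, hL₂c, hW, hL₁, hL₂, hL₁W, hL₂W⟩ :=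
    exists_threeLagrangian_binders W W' v p htors h𝓞 hμ T hT hT0 θ hθ f hf h00 h00'
  exact ThreeLagrangian.addSubgroup_eq_or_inf_eq_bot hp2 q hqs hqnd hH hWc hL₁c hL₂c hW hL₁ hL₂ hL₁W
    hL₂W

end Assembly

end Summit.BirchSwinnertonDyer.Rank1Residual.GaloisImage.ThreeLagrangianCoh

end
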